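import Mathlib
import HarnessLib
import Literature.Analysis.SpecialFunctions.GaussLegendreQuadratureError

/-!
# The error of a Gauss rule for a general weight function (Davis–Rabinowitz §4.4)

Davis–Rabinowitz, *Methods of Numerical Integration* (2nd ed., 1984), Sect. 4.4 "Special Devices",
obtain the error of the `n`-point Gauss rule `G_n` of an admissible weight `w` on `[a, b]` directly,
without Peano kernels [cite: DavisRabinowitz1984, Sect. 4.4 (4.4.1)]:

  THEOREM. If `f ∈ C^{2n}[a, b]`, then
  `E_{G_n}(f) = ∫_a^b w(x) f(x) dx - Σ_{k=1}^{n} w_k f(x_k) = f^{(2n)}(η) / ((2n)! k_n²)`,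
  `a < η < b`,

where `p_n^*(x) = k_n xⁿ + ⋯`, `k_n > 0`, is the orthonormal polynomial, so that
`p_n^* = k_n ∏_k (x - x_k)` and `1/k_n² = ∫_a^b w(x) ∏_k (x - x_k)² dx`.  The proof is the book's:
the Hermite interpolant `h_{2n-1} ∈ 𝒫_{2n-1}` of `f` at the double nodes `x_k` and its remainder
[cite: DavisRabinowitz1984, Sect. 4.4 (4.4.2)]

  `f(x) = h_{2n-1}(x) + f^{(2n)}(ξ(x)) / (2n)! · (x - x_1)² ⋯ (x - x_n)²`, `a < ξ(x) < b`,

multiplication by `w` [cite: DavisRabinowitz1984, Sect. 4.4 (4.4.3)], integration and the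
mean-value theorem for integrals [cite: DavisRabinowitz1984, Sect. 4.4 (4.4.4)], and exactness of
`G_n` on `𝒫_{2n-1}`: `∫ w h_{2n-1} = Σ_k w_k h_{2n-1}(x_k) = Σ_k w_k f(x_k)`.

We state the results for an ARBITRARY rule `f ↦ Σ_{x ∈ s} c_x f(x)` with `n = #s ≥ 1` nodes in
`(a, b)` which is exact on `𝒫_{2n-1}` for the weight `w` (for an admissible weight this property
characterises the Gauss rule, [cite: DavisRabinowitz1984, Sect. 2.7]; that fact is not needed), and
for a weight `w` that is integrable on `[a, b]`, `≥ 0` on `(a, b)`, with `∫_a^b w > 0`: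

* `hermite_remainder_sq_nodes` — the remainder (4.4.2) for any finite set of double nodes in
  `(a, b)`;
* `gaussErrorConst w a b s = ∫_a^b w(x) ∏_{y ∈ s} (x - y)² dx / (2 #s)!` — the constant of (4.4.4);
* `gaussRule_error_mem_Icc` — the two-sided form `m γ ≤ E(f) ≤ M γ` (`γ = gaussErrorConst`)
  whenever `m ≤ f^{(2n)} ≤ M` on `[a, b]` (the shape in which (4.4.1) is used for validated bounds;
  only `w ≥ 0` is needed);
* `gaussRule_error_eq` — (4.4.1): `E(f) = f^{(2n)}(η) γ` with `a < η < b`;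
* `gaussRule_error_eq_leadingCoeff` — (4.4.1) verbatim: if `p = k ∏_{y ∈ s} (X - y)` satisfies
  `∫_a^b w p² = 1` then `E(f) = f^{(2n)}(η) / ((2n)! k²)`;
* `abs_gaussRule_error_le` — `|E(f)| ≤ γ sup_{[a,b]} |f^{(2n)}|`.

The special case `w ≡ 1` on `[-1, 1]` (Gauss–Legendre, [cite: DavisRabinowitz1984, (2.7.11)]) is
`Literature.Analysis.SpecialFunctions.gaussLegendre_error_eq`; we reuse that file's existence lemma
`exists_hermite_interpolant` and follow its Rolle-chain proof of the remainder.  The placement of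
`η` in the OPEN interval for a merely integrable weight is measure-theoretic: if `f^{(2n)}` missed
the required value on `(a, b)`, the integrand of a vanishing integral would be positive off the
nodes wherever `w > 0`, forcing `w = 0` a.e. on `(a, b)` and `∫_a^b w = 0`.

## References

* P. J. Davis, P. Rabinowitz, *Methods of Numerical Integration*, 2nd ed., Academic Press (1984),
  Sect. 4.4, (4.4.1)–(4.4.4). [cite: DavisRabinowitz1984, Sect. 4.4 (4.4.1)]
* J. Stoer, R. Bulirsch, *Introduction to Numerical Analysis*, 3rd ed. (2002), Thm. 2.1.5.10
  (Hermite interpolation remainder), Thm. 3.6.24 (the case `w`, `[a, b]` general is stated there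
  as well). [cite: StoerBulirsch2002, Thm. 3.6.24]

AI-produced formalisation (H21 engines group, cell eng-quad-3, 2026-08-25); Mathlib + HarnessLib +
`Literature.Analysis.SpecialFunctions.GaussLegendreQuadratureError` only; no facts, no axioms
beyond Mathlib's, no `sorry`.
-/

open Polynomial Set MeasureTheory

open scoped Nat

namespace Literature.Analysis.Quadrature

open Literature.Analysis.SpecialFunctions (exists_hermite_interpolant
  iterate_derivative_eq_C_of_natDegree_le)

/-! ### Rolle's theorem on finite zero sets -/

/-- Rolle between consecutive zeros: if the continuous `g` vanishes on a nonempty finite set `s`,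
then `deriv g` vanishes on a finite set `s'` with `#s' + 1 = #s`, each point of `s'` lying strictly
between two points of `s` and outside `s`. [folklore] -/
private theorem rolle_finset {g : ℝ → ℝ} (hg : Continuous g) (s : Finset ℝ) :
    s.Nonempty → (∀ x ∈ s, g x = 0) →
      ∃ s' : Finset ℝ, s'.card + 1 = s.card ∧ (∀ x ∈ s', deriv g x = 0) ∧
        ∀ x ∈ s', x ∉ s ∧ (∃ a ∈ s, a < x) ∧ (∃ b ∈ s, x < b) := by
  classical
  induction s using Finset.induction_on_min with
  | empty => intro hne; exact absurd hne Finset.not_nonempty_empty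
  | insert a t hlt ih =>
    intro _ hzero
    have hat : a ∉ t := fun h => lt_irrefl a (hlt a h)
    rcases t.eq_empty_or_nonempty with rfl | ht
    · exact ⟨∅, by simp, by simp, by simp⟩
    set b := t.min' ht with hb
    have hbt : b ∈ t := Finset.min'_mem t ht
    have hab : a < b := hlt b hbt
    have hga : g a = 0 := hzero a (Finset.mem_insert_self a t)
    have hgb : g b = 0 := hzero b (Finset.mem_insert_of_mem hbt)
    obtain ⟨c, hc, hc0⟩ :=
      exists_deriv_eq_zero (f := g) hab hg.continuousOn (by rw [hga, hgb])
    obtain ⟨t', ht'card, ht'zero, ht'loc⟩ :=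
      ih ht (fun x hx => hzero x (Finset.mem_insert_of_mem hx))
    have hct' : c ∉ t' := by
      intro h
      obtain ⟨-, ⟨a', ha't, ha'c⟩, -⟩ := ht'loc c h
      have : b ≤ a' := Finset.min'_le t a' ha't
      linarith [hc.2]
    refine ⟨insert c t', ?_, ?_, ?_⟩
    · rw [Finset.card_insert_of_notMem hct', Finset.card_insert_of_notMem hat, ht'card]
    · intro x hx
      rcases Finset.mem_insert.mp hx with rfl | hx
      · exact hc0
      · exact ht'zero x hx
    · intro x hx
      rcases Finset.mem_insert.mp hx with rfl | hx
      · refine ⟨?_, ⟨a, Finset.mem_insert_self a t, hc.1⟩,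
          ⟨b, Finset.mem_insert_of_mem hbt, hc.2⟩⟩
        intro hmem
        rcases Finset.mem_insert.mp hmem with h | h
        · exact lt_irrefl a (h ▸ hc.1)
        · have : b ≤ x := Finset.min'_le t x h
          linarith [hc.2]
      · obtain ⟨hxt, ⟨a', ha't, ha'x⟩, ⟨b', hb't, hxb'⟩⟩ := ht'loc x hx
        refine ⟨?_, ⟨a', Finset.mem_insert_of_mem ha't, ha'x⟩,
          ⟨b', Finset.mem_insert_of_mem hb't, hxb'⟩⟩
        intro hmem
        rcases Finset.mem_insert.mp hmem with h | h
        · have := hlt a' ha't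
          rw [h] at ha'x
          linarith
        · exact hxt h

/-- Iterated Rolle on `(a, b)`: if `F ∈ C^N`, `k + m ≤ N`, and `F^{(k)}` vanishes at `m + 1` points
of `(a, b)`, then `F^{(k+m)}` vanishes somewhere in `(a, b)`. [folklore] -/
private theorem rolle_chain {F : ℝ → ℝ} {N : ℕ} (hF : ContDiff ℝ N F) {a b : ℝ} :
    ∀ (m k : ℕ) (S : Finset ℝ), k + m ≤ N → S.card = m + 1 →
      (∀ x ∈ S, x ∈ Ioo a b) → (∀ x ∈ S, iteratedDeriv k F x = 0) →
        ∃ ξ ∈ Ioo a b, iteratedDeriv (k + m) F ξ = 0 := by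
  intro m
  induction m with
  | zero =>
    intro k S _ hcard hS hzero
    obtain ⟨x, hx⟩ := Finset.card_pos.mp (by omega : 0 < S.card)
    exact ⟨x, hS x hx, by simpa using hzero x hx⟩
  | succ m ih =>
    intro k S hkm hcard hS hzero
    have hcont : Continuous (iteratedDeriv k F) :=
      hF.continuous_iteratedDeriv k (by exact_mod_cast (by omega : k ≤ N))
    obtain ⟨S', hS'card, hS'zero, hS'loc⟩ :=
      rolle_finset hcont S (Finset.card_pos.mp (by omega)) hzero
    obtain ⟨ξ, hξ, h⟩ := ih (k + 1) S' (by omega) (by omega)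
      (fun x hx => by
        obtain ⟨-, ⟨a', ha', hax⟩, ⟨b', hb', hxb⟩⟩ := hS'loc x hx
        exact ⟨(hS a' ha').1.trans hax, hxb.trans (hS b' hb').2⟩)
      (fun x hx => by rw [iteratedDeriv_succ]; exact hS'zero x hx)
    exact ⟨ξ, hξ, by rw [show k + (m + 1) = k + 1 + m by ring]; exact h⟩

/-! ### Polynomials as smooth functions -/

/-- Polynomial functions are `C^k`. [folklore] -/
private theorem contDiff_eval_poly (p : ℝ[X]) (k : ℕ) : ContDiff ℝ k fun x => p.eval x := by
  induction p using Polynomial.induction_on' with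
  | add p q hp hq =>
    simp only [eval_add]
    exact hp.add hq
  | monomial m a =>
    simp only [eval_monomial]
    exact contDiff_const.mul (contDiff_id.pow m)

/-- The `k`-th derivative of `x ↦ p(x)` is `x ↦ p^{(k)}(x)`. [folklore] -/
private theorem iteratedDeriv_eval_poly (p : ℝ[X]) (k : ℕ) :
    iteratedDeriv k (fun x => p.eval x) = fun x => (derivative^[k] p).eval x := by
  induction k generalizing p with
  | zero => simp
  | succ k ih =>
    rw [iteratedDeriv_succ', Function.iterate_succ_apply]
    have : deriv (fun x => p.eval x) = fun x => p.derivative.eval x :=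
      funext fun x => Polynomial.deriv p
    rw [this, ih]

/-! ### The nodal polynomial `ω_s = ∏_{y ∈ s} (X - y)` -/

/-- `ω_s = ∏_{y ∈ s} (X - y)`. [folklore] -/
private noncomputable def nodalPoly (s : Finset ℝ) : ℝ[X] := ∏ y ∈ s, (X - C y)

/-- `ω_s(t) = ∏_{y ∈ s} (t - y)`. [folklore] -/
private theorem eval_nodalPoly (s : Finset ℝ) (t : ℝ) :
    (nodalPoly s).eval t = ∏ y ∈ s, (t - y) := by
  simp [nodalPoly, eval_prod]

/-- `ω_s` is monic. [folklore] -/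
private theorem nodalPoly_monic (s : Finset ℝ) : (nodalPoly s).Monic :=
  monic_prod_X_sub_C (fun y => y) s

/-- `deg ω_s = #s`. [folklore] -/
private theorem natDegree_nodalPoly (s : Finset ℝ) : (nodalPoly s).natDegree = s.card :=
  natDegree_finsetProd_X_sub_C_eq_card s (fun y => y)

/-- `ω_s` vanishes at the nodes. [folklore] -/
private theorem eval_nodalPoly_of_mem {s : Finset ℝ} {x : ℝ} (hx : x ∈ s) :
    (nodalPoly s).eval x = 0 := by
  rw [eval_nodalPoly]
  exact Finset.prod_eq_zero hx (sub_self x)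

/-- `ω_s(t) ≠ 0` off the nodes. [folklore] -/
private theorem eval_nodalPoly_ne_zero {s : Finset ℝ} {t : ℝ} (ht : t ∉ s) :
    (nodalPoly s).eval t ≠ 0 := by
  rw [eval_nodalPoly]
  exact Finset.prod_ne_zero_iff.mpr fun y hy => sub_ne_zero.mpr fun h => ht (h ▸ hy)

/-- `∏_{y ∈ s} (t - y)² > 0` off the nodes. [folklore] -/
private theorem prod_sub_sq_pos {s : Finset ℝ} {t : ℝ} (ht : t ∉ s) :
    0 < ∏ y ∈ s, (t - y) ^ 2 := by
  rw [Finset.prod_pow, ← eval_nodalPoly]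
  exact sq_pos_iff.mpr (eval_nodalPoly_ne_zero ht)

/-! ### Hermite interpolation remainder with double nodes (Davis–Rabinowitz (4.4.2)) -/

/-- **Remainder of Hermite interpolation at double nodes** (Davis–Rabinowitz (4.4.2)).  Let `s` be
a nonempty finite set of nodes in `(a, b)`, `n = #s`, `f ∈ C^{2n}`, and let `h` be a polynomial of
degree `< 2n` with `h = f`, `h' = f'` on `s` (it exists:
`Literature.Analysis.SpecialFunctions.exists_hermite_interpolant`).  Then for every `t ∈ [a, b]`
there is `ξ ∈ (a, b)` with
`f(t) - h(t) = f^{(2n)}(ξ) / (2n)! · ∏_{y ∈ s} (t - y)²`.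
[cite: DavisRabinowitz1984, Sect. 4.4 (4.4.2)] -/
theorem hermite_remainder_sq_nodes {a b : ℝ} (s : Finset ℝ) (hs0 : s.Nonempty)
    (hs : ∀ x ∈ s, x ∈ Ioo a b) {f : ℝ → ℝ} (hf : ContDiff ℝ (2 * s.card) f) {h : ℝ[X]}
    (hdeg : h.degree < (2 * s.card : ℕ)) (hval : ∀ x ∈ s, h.eval x = f x)
    (hder : ∀ x ∈ s, h.derivative.eval x = deriv f x) {t : ℝ} (ht : t ∈ Icc a b) :
    ∃ ξ ∈ Ioo a b, f t - h.eval t =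
      iteratedDeriv (2 * s.card) f ξ / (2 * s.card)! * ∏ y ∈ s, (t - y) ^ 2 := by
  classical
  set n := s.card with hn_def
  have hn : 0 < n := Finset.card_pos.mpr hs0
  set P := nodalPoly s with hP
  by_cases htn : t ∈ s
  · refine ⟨t, hs t htn, ?_⟩
    rw [hval t htn, Finset.prod_eq_zero htn (by ring : (t - t) ^ 2 = 0)]
    ring
  have hPt : P.eval t ≠ 0 := eval_nodalPoly_ne_zero htn
  -- the auxiliary function `F = f - h - K P²`, `K` chosen so that `F t = 0`
  set K := (f t - h.eval t) / (P.eval t) ^ 2 with hK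
  set Q : ℝ[X] := h + C K * (P * P) with hQ
  set F : ℝ → ℝ := fun x => f x - Q.eval x with hF
  have hFcd : ContDiff ℝ (2 * n) F := hf.sub (contDiff_eval_poly Q (2 * n))
  have hFcd' : ContDiff ℝ ((2 * n : ℕ) : WithTop ℕ∞) F := by exact_mod_cast hFcd
  have hFnode : ∀ x ∈ s, F x = 0 := by
    intro x hx
    have hPx : P.eval x = 0 := eval_nodalPoly_of_mem hx
    simp only [hF, hQ, eval_add, eval_mul, eval_C, hPx, hval x hx]
    ring
  have hFt : F t = 0 := by
    simp only [hF, hQ, eval_add, eval_mul, eval_C, hK]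
    field_simp
    ring
  have hF'node : ∀ x ∈ s, deriv F x = 0 := by
    intro x hx
    have hPx : P.eval x = 0 := eval_nodalPoly_of_mem hx
    have h2n : (2 * (n : WithTop ℕ∞)) ≠ 0 := by exact_mod_cast (by omega : 2 * n ≠ 0)
    have hfd : DifferentiableAt ℝ f x := (hf.differentiable h2n).differentiableAt
    have hQd : DifferentiableAt ℝ (fun x => Q.eval x) x := Q.differentiableAt
    have : deriv F x = deriv f x - deriv (fun x => Q.eval x) x := by
      simp only [hF]
      exact deriv_fun_sub hfd hQd
    rw [this, Polynomial.deriv, hQ]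
    simp only [derivative_add, derivative_mul, derivative_C, zero_mul, zero_add, eval_add,
      eval_mul, eval_C, hPx, hder x hx]
    ring
  -- first Rolle step on the `n + 1` zeros `s ∪ {t}` (all in `[a, b]`)
  have hS₀card : (insert t s).card = n + 1 := by
    rw [Finset.card_insert_of_notMem htn]
  have hS₀zero : ∀ x ∈ insert t s, F x = 0 := by
    intro x hx
    rcases Finset.mem_insert.mp hx with rfl | hx
    · exact hFt
    · exact hFnode x hx
  have hS₀Icc : ∀ x ∈ insert t s, x ∈ Icc a b := by
    intro x hx
    rcases Finset.mem_insert.mp hx with rfl | hx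
    · exact ht
    · exact Ioo_subset_Icc_self (hs x hx)
  obtain ⟨S₀', hS₀'card, hS₀'zero, hS₀'loc⟩ :=
    rolle_finset hFcd.continuous (insert t s) (Finset.insert_nonempty t _) hS₀zero
  rw [hS₀card] at hS₀'card
  have hdisj : Disjoint S₀' s := by
    rw [Finset.disjoint_left]
    intro x hx hxn
    exact (hS₀'loc x hx).1 (Finset.mem_insert_of_mem hxn)
  have hS₁card : (S₀' ∪ s).card = (2 * n - 1) + 1 := by
    rw [Finset.card_union_of_disjoint hdisj]
    omega
  have hS₁Ioo : ∀ x ∈ S₀' ∪ s, x ∈ Ioo a b := by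
    intro x hx
    rcases Finset.mem_union.mp hx with hx | hx
    · obtain ⟨-, ⟨a', ha', hax⟩, ⟨b', hb', hxb⟩⟩ := hS₀'loc x hx
      exact ⟨(hS₀Icc a' ha').1.trans_lt hax, hxb.trans_le (hS₀Icc b' hb').2⟩
    · exact hs x hx
  have hS₁zero : ∀ x ∈ S₀' ∪ s, iteratedDeriv 1 F x = 0 := by
    intro x hx
    rw [iteratedDeriv_one]
    rcases Finset.mem_union.mp hx with hx | hx
    · exact hS₀'zero x hx
    · exact hF'node x hx
  -- the remaining `2n - 1` Rolle steps
  obtain ⟨ξ, hξ, hξ0⟩ :=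
    rolle_chain hFcd' (2 * n - 1) 1 (S₀' ∪ s) (by omega) hS₁card hS₁Ioo hS₁zero
  rw [show 1 + (2 * n - 1) = 2 * n by omega] at hξ0
  refine ⟨ξ, hξ, ?_⟩
  -- evaluate `F^{(2n)}(ξ) = f^{(2n)}(ξ) - K (2n)!`
  have hsub : iteratedDeriv (2 * n) F ξ =
      iteratedDeriv (2 * n) f ξ - iteratedDeriv (2 * n) (fun x => Q.eval x) ξ := by
    simp only [hF]
    exact iteratedDeriv_fun_sub hf.contDiffAt (contDiff_eval_poly Q (2 * n)).contDiffAt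
  have hPmonic : P.Monic := nodalPoly_monic s
  have hPnat : P.natDegree = n := natDegree_nodalPoly s
  have hPPnat : (P * P).natDegree = 2 * n := by
    rw [hPmonic.natDegree_mul hPmonic, hPnat]; ring
  have hPP : derivative^[2 * n] (P * P) = C ((2 * n)! : ℝ) := by
    rw [iterate_derivative_eq_C_of_natDegree_le hPPnat.le]
    congr 1
    have : (P * P).coeff (2 * n) = 1 := by
      rw [← hPPnat]; exact (hPmonic.mul hPmonic).coeff_natDegree
    rw [this, mul_one]
  have hQ2n : iteratedDeriv (2 * n) (fun x => Q.eval x) ξ = K * (2 * n)! := by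
    rw [iteratedDeriv_eval_poly]
    show (derivative^[2 * n] Q).eval ξ = _
    have hadd : derivative^[2 * n] (h + C K * (P * P)) =
        derivative^[2 * n] h + derivative^[2 * n] (C K * (P * P)) :=
      iterate_map_add derivative (2 * n) h _
    rw [hQ, hadd, iterate_derivative_eq_zero_of_degree_lt hdeg, iterate_derivative_C_mul, hPP,
      zero_add, eval_mul, eval_C, eval_C]
  have hKeq : K = iteratedDeriv (2 * n) f ξ / (2 * n)! := by
    have hD : ((2 * n)! : ℝ) ≠ 0 := by exact_mod_cast Nat.factorial_ne_zero _
    rw [eq_div_iff hD]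
    have := hξ0
    rw [hsub, hQ2n] at this
    linarith
  have hrem : f t - h.eval t = K * (P.eval t) ^ 2 := by
    rw [hK, div_mul_cancel₀ _ (pow_ne_zero 2 hPt)]
  rw [hrem, hKeq, Finset.prod_pow, ← eval_nodalPoly]

/-! ### The error constant and the reduction `E(f) = ∫ w (f - h)` -/

/-- The error constant `γ = γ(w; a, b; s) = ∫_a^b w(x) ∏_{y ∈ s} (x - y)² dx / (2 #s)!` of a rule
with double-node set `s`; for the Gauss rule of an admissible weight, `γ = 1 / ((2n)! k_n²)` with
`k_n` the leading coefficient of the orthonormal polynomial (see `gaussRule_error_eq_leadingCoeff`).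
[cite: DavisRabinowitz1984, Sect. 4.4 (4.4.4)] -/
noncomputable def gaussErrorConst (w : ℝ → ℝ) (a b : ℝ) (s : Finset ℝ) : ℝ :=
  (∫ x in a..b, w x * ∏ y ∈ s, (x - y) ^ 2) / (2 * s.card)!

/-- `x ↦ ∏_{y ∈ s} (x - y)²` is continuous. [folklore] -/
private theorem continuous_prod_sub_sq (s : Finset ℝ) :
    Continuous fun x : ℝ => ∏ y ∈ s, (x - y) ^ 2 :=
  continuous_finsetProd s fun _ _ => (continuous_id.sub continuous_const).pow 2

/-- `∫_a^b w(x) · (c ∏ (x - y)²) dx = c (2#s)! γ`. [folklore] -/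
private theorem integral_w_const_mul_prod {w : ℝ → ℝ} {a b : ℝ} (s : Finset ℝ) (c : ℝ) :
    ∫ x in a..b, w x * (c * ∏ y ∈ s, (x - y) ^ 2) =
      c * ((2 * s.card)! * gaussErrorConst w a b s) := by
  have hD : ((2 * s.card)! : ℝ) ≠ 0 := by exact_mod_cast Nat.factorial_ne_zero _
  rw [gaussErrorConst, mul_div_cancel₀ _ hD, ← intervalIntegral.integral_const_mul]
  congr 1 with x
  ring

/-- Common core: a Hermite interpolant `h` of `f` at the double nodes `s`, the reduction
`E(f) = ∫ w (f - h)` (exactness on `𝒫_{2n-1}`), continuity of `f - h`, and the pointwise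
representation (4.4.2) of `f - h` on `[a, b]`. [folklore] -/
private theorem error_core {a b : ℝ} {w : ℝ → ℝ}
    (hw : IntervalIntegrable w volume a b) (s : Finset ℝ) (hs0 : s.Nonempty)
    (hs : ∀ x ∈ s, x ∈ Ioo a b) (c : ℝ → ℝ)
    (hexact : ∀ p : ℝ[X], p.degree < (2 * s.card : ℕ) →
      ∫ x in a..b, w x * p.eval x = ∑ x ∈ s, c x * p.eval x)
    {f : ℝ → ℝ} (hf : ContDiff ℝ (2 * s.card) f) :
    ∃ h : ℝ[X],
      ((∫ x in a..b, w x * f x) - ∑ x ∈ s, c x * f x =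
          ∫ x in a..b, w x * (f x - h.eval x)) ∧
      Continuous (fun t => f t - h.eval t) ∧
      IntervalIntegrable (fun x => w x * (f x - h.eval x)) volume a b ∧
      ∀ t ∈ Icc a b, ∃ ξ ∈ Ioo a b, f t - h.eval t =
        iteratedDeriv (2 * s.card) f ξ / (2 * s.card)! * ∏ y ∈ s, (t - y) ^ 2 := by
  classical
  obtain ⟨h, hdeg, hh⟩ := exists_hermite_interpolant s f (deriv f)
  have hval : ∀ x ∈ s, h.eval x = f x := fun x hx => (hh x hx).1
  have hder : ∀ x ∈ s, h.derivative.eval x = deriv f x := fun x hx => (hh x hx).2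
  have hfc : Continuous f := hf.continuous
  have hhc : Continuous fun t => h.eval t := h.continuous
  have hRc : Continuous fun t => f t - h.eval t := hfc.sub hhc
  have hwf : IntervalIntegrable (fun x => w x * f x) volume a b :=
    hw.mul_continuousOn hfc.continuousOn
  have hwh : IntervalIntegrable (fun x => w x * h.eval x) volume a b :=
    hw.mul_continuousOn hhc.continuousOn
  have hwR : IntervalIntegrable (fun x => w x * (f x - h.eval x)) volume a b :=
    hw.mul_continuousOn hRc.continuousOn
  refine ⟨h, ?_, hRc, hwR, fun t ht => hermite_remainder_sq_nodes s hs0 hs hf hdeg hval hder ht⟩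
  have hsum : ∑ x ∈ s, c x * f x = ∫ x in a..b, w x * h.eval x := by
    rw [hexact h hdeg]
    exact Finset.sum_congr rfl fun x hx => by rw [hval x hx]
  rw [hsum, ← intervalIntegral.integral_sub hwf hwh]
  congr 1 with x
  ring

/-- The measure-theoretic step: if `w ≥ 0` and `ψ ≥ 0` on `(a, b)`, `ψ > 0` on `(a, b)` off the
finite set `s`, and `∫_a^b w ψ = 0`, then `∫_a^b w = 0`. [folklore] -/
private theorem integral_eq_zero_of_integral_mul_eq_zero {a b : ℝ} (hab : a < b) {w ψ : ℝ → ℝ}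
    (hwψ : IntervalIntegrable (fun x => w x * ψ x) volume a b)
    (hw0 : ∀ x ∈ Ioo a b, 0 ≤ w x) (hψ0 : ∀ x ∈ Ioo a b, 0 ≤ ψ x) (s : Finset ℝ)
    (hψpos : ∀ x ∈ Ioo a b, x ∉ s → 0 < ψ x) (hint : ∫ x in a..b, w x * ψ x = 0) :
    ∫ x in a..b, w x = 0 := by
  rw [intervalIntegral.integral_of_le hab.le, integral_Ioc_eq_integral_Ioo] at hint ⊢
  have hmeas : MeasurableSet (Ioo a b) := measurableSet_Ioo
  have hnn : 0 ≤ᵐ[volume.restrict (Ioo a b)] fun x => w x * ψ x :=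
    ae_restrict_of_forall_mem hmeas fun x hx => mul_nonneg (hw0 x hx) (hψ0 x hx)
  have hio : IntegrableOn (fun x => w x * ψ x) (Ioo a b) volume :=
    hwψ.1.mono_set Ioo_subset_Ioc_self
  have hae : (fun x => w x * ψ x) =ᵐ[volume.restrict (Ioo a b)] 0 :=
    (setIntegral_eq_zero_iff_of_nonneg_ae hnn hio).mp hint
  have hs_ae : ∀ᵐ x ∂(volume.restrict (Ioo a b)), x ∉ (s : Set ℝ) :=
    ae_restrict_of_ae ((s : Set ℝ).toFinite.countable.ae_notMem volume)
  have hmem : ∀ᵐ x ∂(volume.restrict (Ioo a b)), x ∈ Ioo a b := ae_restrict_mem hmeas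
  have hw_ae : w =ᵐ[volume.restrict (Ioo a b)] 0 := by
    filter_upwards [hae, hs_ae, hmem] with x hx hxs hxI
    have hψ := hψpos x hxI (by exact_mod_cast hxs)
    have hx' : w x * ψ x = 0 := by simpa using hx
    simpa using (mul_eq_zero.mp hx').resolve_right hψ.ne'
  rw [integral_congr_ae hw_ae]
  simp

/-! ### The error theorems (Davis–Rabinowitz (4.4.1)) -/

/-- **Two-sided error bound for a rule exact on `𝒫_{2n-1}`** (the bracketing form of
Davis–Rabinowitz (4.4.1)/(4.4.4)).  Let `w` be integrable on `[a, b]` and `≥ 0` on `(a, b)`, let the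
rule `Σ_{x ∈ s} c_x f(x)` with `n = #s ≥ 1` nodes in `(a, b)` be exact for `w` on all polynomials
of degree `< 2n`, and let `f ∈ C^{2n}` with `m ≤ f^{(2n)} ≤ M` on `[a, b]`.  Then
`m γ ≤ ∫_a^b w f - Σ c_x f(x) ≤ M γ`, `γ = ∫_a^b w ∏ (x - y)² / (2n)!`.
[cite: DavisRabinowitz1984, Sect. 4.4 (4.4.1)] -/
theorem gaussRule_error_mem_Icc {a b : ℝ} (hab : a < b) {w : ℝ → ℝ}
    (hw : IntervalIntegrable w volume a b) (hw0 : ∀ x ∈ Ioo a b, 0 ≤ w x)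
    (s : Finset ℝ) (hs0 : s.Nonempty) (hs : ∀ x ∈ s, x ∈ Ioo a b) (c : ℝ → ℝ)
    (hexact : ∀ p : ℝ[X], p.degree < (2 * s.card : ℕ) →
      ∫ x in a..b, w x * p.eval x = ∑ x ∈ s, c x * p.eval x)
    {f : ℝ → ℝ} (hf : ContDiff ℝ (2 * s.card) f) {m M : ℝ}
    (hm : ∀ x ∈ Icc a b, m ≤ iteratedDeriv (2 * s.card) f x)
    (hM : ∀ x ∈ Icc a b, iteratedDeriv (2 * s.card) f x ≤ M) :
    (∫ x in a..b, w x * f x) - ∑ x ∈ s, c x * f x ∈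
      Icc (m * gaussErrorConst w a b s) (M * gaussErrorConst w a b s) := by
  obtain ⟨h, hE, hRc, hwR, hrep⟩ := error_core hw s hs0 hs c hexact hf
  have hD : (0 : ℝ) < (2 * s.card)! := by exact_mod_cast Nat.factorial_pos _
  have hwc : ∀ c' : ℝ,
      IntervalIntegrable (fun x => w x * (c' / (2 * s.card)! * ∏ y ∈ s, (x - y) ^ 2))
        volume a b := fun c' =>
    hw.mul_continuousOn (continuous_const.mul (continuous_prod_sub_sq s)).continuousOn
  have hI : ∀ c' : ℝ, ∫ x in a..b, w x * (c' / (2 * s.card)! * ∏ y ∈ s, (x - y) ^ 2) =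
      c' * gaussErrorConst w a b s := by
    intro c'
    rw [integral_w_const_mul_prod s (c' / (2 * s.card)!)]
    field_simp
  rw [hE]
  constructor
  · rw [← hI m]
    refine intervalIntegral.integral_mono_on_of_le_Ioo hab.le (hwc m) hwR fun x hx => ?_
    obtain ⟨ξ, hξ, hr⟩ := hrep x (Ioo_subset_Icc_self hx)
    rw [hr]
    refine mul_le_mul_of_nonneg_left ?_ (hw0 x hx)
    exact mul_le_mul_of_nonneg_right (div_le_div_of_nonneg_right (hm ξ (Ioo_subset_Icc_self hξ))
      hD.le) (Finset.prod_nonneg fun y _ => sq_nonneg _)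
  · rw [← hI M]
    refine intervalIntegral.integral_mono_on_of_le_Ioo hab.le hwR (hwc M) fun x hx => ?_
    obtain ⟨ξ, hξ, hr⟩ := hrep x (Ioo_subset_Icc_self hx)
    rw [hr]
    refine mul_le_mul_of_nonneg_left ?_ (hw0 x hx)
    exact mul_le_mul_of_nonneg_right (div_le_div_of_nonneg_right (hM ξ (Ioo_subset_Icc_self hξ))
      hD.le) (Finset.prod_nonneg fun y _ => sq_nonneg _)

/-- The error constant is positive when, in addition, `∫_a^b w > 0`. [folklore] -/
private theorem gaussErrorConst_pos {a b : ℝ} (hab : a < b) {w : ℝ → ℝ}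
    (hw : IntervalIntegrable w volume a b) (hw0 : ∀ x ∈ Ioo a b, 0 ≤ w x)
    (hwpos : 0 < ∫ x in a..b, w x) (s : Finset ℝ) : 0 < gaussErrorConst w a b s := by
  have hD : (0 : ℝ) < (2 * s.card)! := by exact_mod_cast Nat.factorial_pos _
  have hwP : IntervalIntegrable (fun x => w x * ∏ y ∈ s, (x - y) ^ 2) volume a b :=
    hw.mul_continuousOn (continuous_prod_sub_sq s).continuousOn
  have hnn : 0 ≤ ∫ x in a..b, w x * ∏ y ∈ s, (x - y) ^ 2 := by
    have h0 : ∫ x in a..b, (0 : ℝ) = 0 := by simp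
    rw [← h0]
    exact intervalIntegral.integral_mono_on_of_le_Ioo hab.le (by simp) hwP fun x hx =>
      mul_nonneg (hw0 x hx) (Finset.prod_nonneg fun y _ => sq_nonneg _)
  rcases hnn.lt_or_eq with hpos | hzero
  · exact div_pos hpos hD
  · exfalso
    have := integral_eq_zero_of_integral_mul_eq_zero hab (ψ := fun x => ∏ y ∈ s, (x - y) ^ 2)
      hwP hw0 (fun x _ => Finset.prod_nonneg fun y _ => sq_nonneg _) s
      (fun x _ hxs => prod_sub_sq_pos hxs) hzero.symm
    linarith

/-- **The error of a Gauss rule for a general weight** (Davis–Rabinowitz (4.4.1)).  Let `w` be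
integrable on `[a, b]`, `≥ 0` on `(a, b)`, with `∫_a^b w > 0`; let `Σ_{x ∈ s} c_x f(x)` be a rule
with `n = #s ≥ 1` nodes in `(a, b)` that is exact for `w` on all polynomials of degree `< 2n`
(the Gauss rule `G_n` of `w`); and let `f ∈ C^{2n}`.  Then for some `η ∈ (a, b)`,
`∫_a^b w f - Σ_{x ∈ s} c_x f(x) = f^{(2n)}(η) · ∫_a^b w(x) ∏_{y ∈ s} (x - y)² dx / (2n)!`.
[cite: DavisRabinowitz1984, Sect. 4.4 (4.4.1)] -/
theorem gaussRule_error_eq {a b : ℝ} (hab : a < b) {w : ℝ → ℝ}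
    (hw : IntervalIntegrable w volume a b) (hw0 : ∀ x ∈ Ioo a b, 0 ≤ w x)
    (hwpos : 0 < ∫ x in a..b, w x)
    (s : Finset ℝ) (hs0 : s.Nonempty) (hs : ∀ x ∈ s, x ∈ Ioo a b) (c : ℝ → ℝ)
    (hexact : ∀ p : ℝ[X], p.degree < (2 * s.card : ℕ) →
      ∫ x in a..b, w x * p.eval x = ∑ x ∈ s, c x * p.eval x)
    {f : ℝ → ℝ} (hf : ContDiff ℝ (2 * s.card) f) :
    ∃ η ∈ Ioo a b, (∫ x in a..b, w x * f x) - ∑ x ∈ s, c x * f x =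
      iteratedDeriv (2 * s.card) f η * gaussErrorConst w a b s := by
  classical
  obtain ⟨h, hE, hRc, hwR, hrep⟩ := error_core hw s hs0 hs c hexact hf
  set q := iteratedDeriv (2 * s.card) f with hq
  set γ := gaussErrorConst w a b s with hγ
  set E := (∫ x in a..b, w x * f x) - ∑ x ∈ s, c x * f x with hEdef
  have hγ0 : 0 < γ := gaussErrorConst_pos hab hw hw0 hwpos s
  have hD : (0 : ℝ) < (2 * s.card)! := by exact_mod_cast Nat.factorial_pos _
  have hqc : Continuous q := hf.continuous_iteratedDeriv (2 * s.card) le_rfl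
  -- extrema of `q` on `[a, b]`
  have hne : (Icc a b).Nonempty := nonempty_Icc.mpr hab.le
  obtain ⟨xm, hxm, hmin⟩ := isCompact_Icc.exists_isMinOn hne hqc.continuousOn
  obtain ⟨xM, hxM, hmax⟩ := isCompact_Icc.exists_isMaxOn hne hqc.continuousOn
  have hbounds := gaussRule_error_mem_Icc hab hw hw0 s hs0 hs c hexact hf (m := q xm) (M := q xM)
    (fun x hx => hmin hx) (fun x hx => hmax hx)
  rw [← hEdef] at hbounds
  -- an extremal value `v` with `E = v γ` is attained by `q` inside `(a, b)`
  have hPc := continuous_prod_sub_sq s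
  have attained : ∀ v : ℝ, E = v * γ →
      ((∀ x ∈ Icc a b, v ≤ q x) ∨ (∀ x ∈ Icc a b, q x ≤ v)) → ∃ η ∈ Ioo a b, q η = v := by
    intro v hEv hside
    by_contra hcon
    push Not at hcon
    -- `ψ = ± ((f - h) - v/(2n)! ∏ (x - y)²)` is `≥ 0` on `(a, b)`, `> 0` off the nodes, `∫ w ψ = 0`
    have hwP : IntervalIntegrable
        (fun x => w x * (v / (2 * s.card)! * ∏ y ∈ s, (x - y) ^ 2)) volume a b :=
      hw.mul_continuousOn (continuous_const.mul hPc).continuousOn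
    have hIv : ∫ x in a..b, w x * (v / (2 * s.card)! * ∏ y ∈ s, (x - y) ^ 2) = v * γ := by
      rw [integral_w_const_mul_prod s (v / (2 * s.card)!), hγ]
      field_simp
    have hrepv : ∀ x ∈ Ioo a b, ∃ ξ ∈ Ioo a b,
        (f x - h.eval x) - v / (2 * s.card)! * ∏ y ∈ s, (x - y) ^ 2 =
          (q ξ - v) / (2 * s.card)! * ∏ y ∈ s, (x - y) ^ 2 := by
      intro x hx
      obtain ⟨ξ, hξ, hr⟩ := hrep x (Ioo_subset_Icc_self hx)
      exact ⟨ξ, hξ, by rw [hr]; ring⟩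
    rcases hside with hlo | hhi
    · set ψ : ℝ → ℝ := fun x => (f x - h.eval x) - v / (2 * s.card)! * ∏ y ∈ s, (x - y) ^ 2
        with hψ
      have heq : (fun x => w x * ψ x) = fun x =>
          w x * (f x - h.eval x) - w x * (v / (2 * s.card)! * ∏ y ∈ s, (x - y) ^ 2) := by
        funext x; simp only [hψ]; ring
      have hwψ : IntervalIntegrable (fun x => w x * ψ x) volume a b := by
        rw [heq]; exact hwR.sub hwP
      have hψ0 : ∀ x ∈ Ioo a b, 0 ≤ ψ x := by
        intro x hx
        obtain ⟨ξ, hξ, hr⟩ := hrepv x hx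
        simp only [hψ]
        rw [hr]
        exact mul_nonneg (div_nonneg (sub_nonneg.mpr (hlo ξ (Ioo_subset_Icc_self hξ))) hD.le)
          (Finset.prod_nonneg fun y _ => sq_nonneg _)
      have hψpos : ∀ x ∈ Ioo a b, x ∉ s → 0 < ψ x := by
        intro x hx hxs
        obtain ⟨ξ, hξ, hr⟩ := hrepv x hx
        simp only [hψ]
        rw [hr]
        refine mul_pos (div_pos (sub_pos.mpr ?_) hD) (prod_sub_sq_pos hxs)
        exact lt_of_le_of_ne (hlo ξ (Ioo_subset_Icc_self hξ)) fun h' => hcon ξ hξ h'.symm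
      have hint : ∫ x in a..b, w x * ψ x = 0 := by
        rw [heq, intervalIntegral.integral_sub hwR hwP, ← hE, hIv, hEv, sub_self]
      have key := integral_eq_zero_of_integral_mul_eq_zero hab hwψ hw0 hψ0 s hψpos hint
      linarith
    · set ψ : ℝ → ℝ := fun x => v / (2 * s.card)! * ∏ y ∈ s, (x - y) ^ 2 - (f x - h.eval x)
        with hψ
      have heq : (fun x => w x * ψ x) = fun x =>
          w x * (v / (2 * s.card)! * ∏ y ∈ s, (x - y) ^ 2) - w x * (f x - h.eval x) := by
        funext x; simp only [hψ]; ring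
      have hwψ : IntervalIntegrable (fun x => w x * ψ x) volume a b := by
        rw [heq]; exact hwP.sub hwR
      have hrepv' : ∀ x ∈ Ioo a b, ∃ ξ ∈ Ioo a b, ψ x = (v - q ξ) / (2 * s.card)! *
          ∏ y ∈ s, (x - y) ^ 2 := by
        intro x hx
        obtain ⟨ξ, hξ, hr⟩ := hrep x (Ioo_subset_Icc_self hx)
        exact ⟨ξ, hξ, by simp only [hψ]; rw [hr]; ring⟩
      have hψ0 : ∀ x ∈ Ioo a b, 0 ≤ ψ x := by
        intro x hx
        obtain ⟨ξ, hξ, hr⟩ := hrepv' x hx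
        rw [hr]
        exact mul_nonneg (div_nonneg (sub_nonneg.mpr (hhi ξ (Ioo_subset_Icc_self hξ))) hD.le)
          (Finset.prod_nonneg fun y _ => sq_nonneg _)
      have hψpos : ∀ x ∈ Ioo a b, x ∉ s → 0 < ψ x := by
        intro x hx hxs
        obtain ⟨ξ, hξ, hr⟩ := hrepv' x hx
        rw [hr]
        refine mul_pos (div_pos (sub_pos.mpr ?_) hD) (prod_sub_sq_pos hxs)
        exact lt_of_le_of_ne (hhi ξ (Ioo_subset_Icc_self hξ)) (hcon ξ hξ)
      have hint : ∫ x in a..b, w x * ψ x = 0 := by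
        rw [heq, intervalIntegral.integral_sub hwP hwR, ← hE, hIv, hEv, sub_self]
      have key := integral_eq_zero_of_integral_mul_eq_zero hab hwψ hw0 hψ0 s hψpos hint
      linarith
  -- case analysis on where `E/γ` sits in `[q xm, q xM]`
  by_cases hlo : E ≤ q xm * γ
  · have hEq : E = q xm * γ := le_antisymm hlo hbounds.1
    obtain ⟨η, hη, hqη⟩ := attained (q xm) hEq (Or.inl fun x hx => hmin hx)
    exact ⟨η, hη, by rw [hEq, hqη]⟩
  by_cases hhi : q xM * γ ≤ E
  · have hEq : E = q xM * γ := le_antisymm hbounds.2 hhi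
    obtain ⟨η, hη, hqη⟩ := attained (q xM) hEq (Or.inr fun x hx => hmax hx)
    exact ⟨η, hη, by rw [hEq, hqη]⟩
  push Not at hlo hhi
  -- strict intermediate value between `xm` and `xM`
  have hc : E / γ ∈ Ioo (q xm) (q xM) := by
    constructor
    · rwa [lt_div_iff₀ hγ0]
    · rwa [div_lt_iff₀ hγ0]
  rcases le_total xm xM with hmM | hMm
  · have hIcc : Icc xm xM ⊆ Icc a b := Icc_subset_Icc hxm.1 hxM.2
    obtain ⟨η, hη, hqη⟩ := intermediate_value_Ioo hmM (hqc.continuousOn.mono hIcc) hc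
    refine ⟨η, ⟨hxm.1.trans_lt hη.1, hη.2.trans_le hxM.2⟩, ?_⟩
    rw [hqη, div_mul_cancel₀ _ hγ0.ne']
  · have hIcc : Icc xM xm ⊆ Icc a b := Icc_subset_Icc hxM.1 hxm.2
    obtain ⟨η, hη, hqη⟩ := intermediate_value_Ioo' hMm (hqc.continuousOn.mono hIcc) hc
    refine ⟨η, ⟨hxM.1.trans_lt hη.1, hη.2.trans_le hxm.2⟩, ?_⟩
    rw [hqη, div_mul_cancel₀ _ hγ0.ne']

/-- **Davis–Rabinowitz (4.4.1) verbatim.**  In the situation of `gaussRule_error_eq`, if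
`p = k · ∏_{y ∈ s} (X - y)` (the orthonormal polynomial `p_n^* = k_n xⁿ + ⋯` whose zeros are the
Gauss nodes) satisfies `∫_a^b w p² = 1`, then
`∫_a^b w f - Σ_{x ∈ s} c_x f(x) = f^{(2n)}(η) / ((2n)! k²)` for some `η ∈ (a, b)`.
[cite: DavisRabinowitz1984, Sect. 4.4 (4.4.1)] -/
theorem gaussRule_error_eq_leadingCoeff {a b : ℝ} (hab : a < b) {w : ℝ → ℝ}
    (hw : IntervalIntegrable w volume a b) (hw0 : ∀ x ∈ Ioo a b, 0 ≤ w x)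
    (hwpos : 0 < ∫ x in a..b, w x)
    (s : Finset ℝ) (hs0 : s.Nonempty) (hs : ∀ x ∈ s, x ∈ Ioo a b) (c : ℝ → ℝ)
    (hexact : ∀ p : ℝ[X], p.degree < (2 * s.card : ℕ) →
      ∫ x in a..b, w x * p.eval x = ∑ x ∈ s, c x * p.eval x)
    {k : ℝ} {p : ℝ[X]} (hp : p = C k * ∏ y ∈ s, (X - C y))
    (horth : ∫ x in a..b, w x * (p.eval x) ^ 2 = 1)
    {f : ℝ → ℝ} (hf : ContDiff ℝ (2 * s.card) f) :
    ∃ η ∈ Ioo a b, (∫ x in a..b, w x * f x) - ∑ x ∈ s, c x * f x =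
      iteratedDeriv (2 * s.card) f η / ((2 * s.card)! * k ^ 2) := by
  obtain ⟨η, hη, hEq⟩ := gaussRule_error_eq hab hw hw0 hwpos s hs0 hs c hexact hf
  refine ⟨η, hη, ?_⟩
  have hD : ((2 * s.card)! : ℝ) ≠ 0 := by exact_mod_cast Nat.factorial_ne_zero _
  -- `∫ w p² = k² (2n)! γ`, hence `k² (2n)! γ = 1`
  have hpeval : ∀ x, (p.eval x) ^ 2 = k ^ 2 * ∏ y ∈ s, (x - y) ^ 2 := by
    intro x
    simp [hp, eval_prod, mul_pow, Finset.prod_pow]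
  have hk : k ^ 2 * ((2 * s.card)! * gaussErrorConst w a b s) = 1 := by
    rw [← integral_w_const_mul_prod s (k ^ 2), ← horth]
    congr 1 with x
    rw [hpeval]
  have hk0 : k ^ 2 ≠ 0 := by
    intro h0
    rw [h0, zero_mul] at hk
    exact zero_ne_one hk
  have hγ : gaussErrorConst w a b s = 1 / ((2 * s.card)! * k ^ 2) := by
    rw [eq_div_iff (mul_ne_zero hD hk0)]
    linear_combination hk
  rw [hEq, hγ]
  ring

/-- Corollary: `|∫_a^b w f - Σ_{x ∈ s} c_x f(x)| ≤ γ · M` whenever `|f^{(2n)}| ≤ M` on `[a, b]`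
(`γ = gaussErrorConst w a b s`; only `w ≥ 0` on `(a, b)` is needed).
[cite: DavisRabinowitz1984, Sect. 4.4 (4.4.1)] -/
theorem abs_gaussRule_error_le {a b : ℝ} (hab : a < b) {w : ℝ → ℝ}
    (hw : IntervalIntegrable w volume a b) (hw0 : ∀ x ∈ Ioo a b, 0 ≤ w x)
    (s : Finset ℝ) (hs0 : s.Nonempty) (hs : ∀ x ∈ s, x ∈ Ioo a b) (c : ℝ → ℝ)
    (hexact : ∀ p : ℝ[X], p.degree < (2 * s.card : ℕ) →
      ∫ x in a..b, w x * p.eval x = ∑ x ∈ s, c x * p.eval x)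
    {f : ℝ → ℝ} (hf : ContDiff ℝ (2 * s.card) f) {M : ℝ}
    (hM : ∀ x ∈ Icc a b, |iteratedDeriv (2 * s.card) f x| ≤ M) :
    |(∫ x in a..b, w x * f x) - ∑ x ∈ s, c x * f x| ≤ gaussErrorConst w a b s * M := by
  have h := gaussRule_error_mem_Icc hab hw hw0 s hs0 hs c hexact hf (m := -M) (M := M)
    (fun x hx => (abs_le.mp (hM x hx)).1) (fun x hx => (abs_le.mp (hM x hx)).2)
  have hγ : 0 ≤ gaussErrorConst w a b s := by
    have hD : (0 : ℝ) < (2 * s.card)! := by exact_mod_cast Nat.factorial_pos _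
    refine div_nonneg ?_ hD.le
    have h0 : ∫ x in a..b, (0 : ℝ) = 0 := by simp
    rw [← h0]
    exact intervalIntegral.integral_mono_on_of_le_Ioo hab.le (by simp)
      (hw.mul_continuousOn (continuous_prod_sub_sq s).continuousOn) fun x hx =>
      mul_nonneg (hw0 x hx) (Finset.prod_nonneg fun y _ => sq_nonneg _)
  rw [abs_le]
  constructor <;> nlinarith [h.1, h.2, hγ]

end Literature.Analysis.Quadrature
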